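import Literature.NumberTheory.EllipticCurves.DeligneHeckeEigenvalueBoundProofs
import Literature.NumberTheory.EllipticCurves.CuspFormLFunctionEulerProductProofs
import Literature.NumberTheory.EllipticCurves.CuspFormLFunctionLevelConductorProofs
import Literature.NumberTheory.EllipticCurves.HidaFamilyMembersProofs
import Literature.NumberTheory.EllipticCurves.LSeriesHeckeRecursionNonvanishingProofs
import Literature.NumberTheory.EllipticCurves.LFunctionCoefficientBound
import Mathlib.FieldTheory.IsAlgClosed.Basic
import HarnessLib

/-!
# Non-vanishing of `L(f, s)` in DELIGNE's half-plane `re s > (k+1)/2` for a newform `f ∈ S_k(Γ₀(N))`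
# (granted Deligne's bound), in particular at the boundary `re s = k/2 + 1` of Hecke's half-plane

Theorems only (no definition, no new named fact). Companion of
`CuspFormLFunctionCriticalNonvanishingProofs` (`IsNewform0.cuspFormLSeries_ne_zero`: `L(f, s) ≠ 0` for
`re s > k/2 + 1`, from Hecke's trivial bound `aₙ ≪ n^{k/2}`), whose docstring records: "The boundary
case `2n + 2 = k` (absolute convergence at `re s = k/2 + 1`) needs Deligne's bound and is not treated."
Here it is treated, GRANTED the tree's named fact `Deligne1974_heckeT_eigenvalue_norm_le` (Deligne,
*Weil I*, Thm. 8.2 in the Murty–Sinha form: every eigenvalue of `T_p` on `S_k(Γ₀(N))`, `p ∤ N`, has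
absolute value `≤ 2 p^{(k-1)/2}`; `DeligneHeckeEigenvalueBound.lean`), carried as an explicit
hypothesis `hD` by every theorem that uses it:

* (private) `norm_le_of_recurrence_of_norm_eq` — the two-root recurrence with roots of absolute value `R`:
  `|c_r| ≤ (r+1) R^r` (scaled form of `LanglandsTunnellLSeries`' `norm_le_of_recurrence`);
* `IsNewform0.exists_roots_of_deligne` — for `p ∤ N` the Hecke polynomial `T² − a_p T + p^{k−1}`
  factors with both roots of absolute value `p^{(k−1)/2}` (`Deligne1974_heckeT_eigenvalue_norm_le.norm_root_eq`,
  i.e. Deligne's "en d'autres termes", which uses that `a_p` is real);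
* `IsNewform0.norm_cuspCoeff_le_rpow_of_dvd` — for `p ∣ N`: `|a_p| ≤ p^{(k−1)/2}` UNCONDITIONALLY
  (`a_p = 0` if `p² ∣ N`, `IsNewform0.cuspCoeff_eq_zero_of_sq_dvd`; `a_p² = p^{k−2}` if `p ∥ N`,
  `IsNewform0.coeff_sq_eq_of_exactly_dvd`; Atkin–Lehner 1970, Thm. 3);
* `IsNewform0.norm_cuspCoeff_prime_pow_le_of_deligne` — `|a_{p^r}| ≤ (r+1) p^{r(k−1)/2}` at EVERY
  prime (Hecke recursion `IsNewform0.cuspCoeff_prime_pow_add_two_weight`, Diamond–Shurman Prop. 5.8.5);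
* `IsNewform0.norm_cuspCoeff_le_of_deligne` — the Ramanujan–Petersson bound in the crude but
  sufficient form `|aₙ| ≤ 16^{256} · n^{(k−1)/2 + 1/8}` (`n ≥ 1`; multiplicativity
  `IsNewform0.coeff_mul_of_coprime_holds` and the divisor-function absorption
  `(r+1) ≤ B_p p^{r/8}`, `B_p = 16` for `p < 256`, `= 1` beyond, of `LFunctionCoefficientBound`);
* `IsNewform0.lseriesSummable_cuspCoeff_of_deligne` — `∑ aₙ n^{-s}` converges absolutely for
  `re s > (k+1)/2 + 1/8`;
* `IsNewform0.cuspFormLSeries_ne_zero_of_deligne` — `L(f, s) ≠ 0` there (the sieve argument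
  `HeckeRecursionLSeries.LSeries_ne_zero_of_heckeRecursion`, classically the Euler product,
  Diamond–Shurman Thm. 5.9.2), with the two shapes consumers want:
  `IsNewform0.cuspFormLSeries_ne_zero_of_le_re_of_deligne` (`re s ≥ k/2 + 1`: Hecke's boundary
  included) and `IsNewform0.cuspFormLSeries_edge_ne_zero_of_deligne` (`L(f, k−1) ≠ 0`, the last
  critical value, for `k ≥ 4`).

The exponent `(k+1)/2 + 1/8` (rather than Deligne's abscissa `(k+1)/2`) is an artefact of the
elementary divisor bound `d(n) ≤ 16^{256} n^{1/8}` used by the tree; it covers every critical or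
half-integral point `s ≥ k/2 + 1`, which is what the consumers need: the weight-`4` edge value
`L(g, 3)` of the companion form at `p = 3` in the line `edge_seed_rigidity` of crux
`KobayashiLowerHalfLargeImage` (item stmt-BirchSwinnertonDyer-19001; its stub `stub_companionEdge` /
`stub_three`), and the reference ratios of crux `EdgeCap` (stmt-BirchSwinnertonDyer-17609) at
`2j + 2 = k`. Nothing here is specific to elliptic curves; nothing asserts Deligne's theorem.

References: Deligne, *La conjecture de Weil. I*, Publ. Math. IHÉS 43 (1974), Thm. 8.2 [Deligne1974];
Atkin–Lehner, Math. Ann. 185 (1970), Thm. 3 [AtkinLehner1970]; Diamond–Shurman, GTM 228, Prop. 5.8.5,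
Thm. 5.9.2 [DiamondShurman2005].
-/

noncomputable section

open scoped MatrixGroups ModularForm

open CongruenceSubgroup UpperHalfPlane Complex

namespace Literature.NumberTheory.EllipticCurves.ModularForms

/-! ### The two-root recurrence with roots of absolute value `R` -/

/-- If `c₀ = 1`, `c₁ = l + m`, `c_{r+2} = (l+m) c_{r+1} − l m c_r` and `|l| = |m| = R`, then
`c_r = ∑_{i+j=r} lⁱ mʲ` has `|c_r| ≤ (r + 1) R^r`. (Scaled form of `norm_le_of_recurrence` of
`LanglandsTunnellLSeriesProofs`, where `R = 1`.) [folklore] -/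
private theorem norm_le_of_recurrence_of_norm_eq {l m : ℂ} {R : ℝ} (hR : 0 ≤ R) (hl : ‖l‖ = R)
    (hm : ‖m‖ = R) {c : ℕ → ℂ} (h0 : c 0 = 1) (h1 : c 1 = l + m)
    (hrec : ∀ r, c (r + 2) = (l + m) * c (r + 1) - l * m * c r) (r : ℕ) :
    ‖c r‖ ≤ ((r : ℝ) + 1) * R ^ r := by
  have hu : ∀ r, c (r + 1) - l * c r = m ^ (r + 1) := by
    intro r
    induction r with
    | zero => rw [h1, h0]; ring
    | succ r ih => rw [hrec, pow_succ, ← ih]; ring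
  induction r with
  | zero => simp [h0]
  | succ r ih =>
    have hc : c (r + 1) = l * c r + m ^ (r + 1) := by rw [← hu]; ring
    rw [hc]
    push_cast
    calc ‖l * c r + m ^ (r + 1)‖ ≤ ‖l * c r‖ + ‖m ^ (r + 1)‖ := norm_add_le _ _
      _ = R * ‖c r‖ + R ^ (r + 1) := by rw [norm_mul, norm_pow, hl, hm]
      _ ≤ R * (((r : ℝ) + 1) * R ^ r) + R ^ (r + 1) := by gcongr
      _ = ((r : ℝ) + 1 + 1) * R ^ (r + 1) := by ring

/-! ### Coefficient bounds for a newform on `Γ₀(N)` -/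

section Newform

variable {N : ℕ} [NeZero N] {k : ℤ} {f : CuspForm (Gamma0 N) k}

/-- **Deligne's bound, root form, for a newform**: granted `Deligne1974_heckeT_eigenvalue_norm_le`,
for a newform `f ∈ S_k(Γ₀(N))` (`k ≥ 2`) and a prime `p ∤ N` the Hecke polynomial
`T² − a_p(f) T + p^{k−1}` splits as `(T − l)(T − m)` with `|l| = |m| = p^{(k−1)/2}` (Deligne, Weil I,
Thm. 8.2, "en d'autres termes"; `a_p(f)` is the `T_p`-eigenvalue of the non-zero eigenvector `f`).
[cite: Deligne1974, Thm. 8.2 (p. 302)] -/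
theorem IsNewform0.exists_roots_of_deligne (hD : Deligne1974_heckeT_eigenvalue_norm_le)
    (hf : IsNewform0 f) (hk : 2 ≤ k) {p : ℕ} (hp : p.Prime) (hpN : ¬ p ∣ N) :
    ∃ l m : ℂ, l + m = cuspCoeff f p ∧ l * m = (p : ℂ) ^ (k - 1) ∧
      ‖l‖ = (p : ℝ) ^ (((k : ℝ) - 1) / 2) ∧ ‖m‖ = (p : ℝ) ^ (((k : ℝ) - 1) / 2) := by
  haveI : NeZero p := ⟨hp.ne_zero⟩
  set a : ℂ := cuspCoeff f p with ha
  -- `a_p(f)` is an eigenvalue of `T_p` (the newform `f ≠ 0` is an eigenvector)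
  have hμ : Module.End.HasEigenvalue (heckeT (Gamma0 N) k p) a :=
    Module.End.hasEigenvalue_of_hasEigenvector (Module.End.hasEigenvector_iff.2
      ⟨Module.End.mem_eigenspace_iff.2 (hf.heckeT_eq_coeff_smul hp),
        IsNormalized.ne_zero_gamma0 hf.2.2⟩)
  -- a square root of the discriminant
  obtain ⟨s, hs⟩ := IsAlgClosed.exists_pow_nat_eq (a ^ 2 - 4 * (p : ℂ) ^ (k - 1)) two_pos
  refine ⟨(a + s) / 2, (a - s) / 2, by ring, by linear_combination (-1 / 4 : ℂ) * hs, ?_, ?_⟩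
  · exact hD.norm_root_eq hk hp hpN hμ (by linear_combination (1 / 4 : ℂ) * hs)
  · exact hD.norm_root_eq hk hp hpN hμ (by linear_combination (1 / 4 : ℂ) * hs)

/-- **`|a_{p^r}(f)| ≤ (r+1) p^{r(k−1)/2}` at a prime `p ∤ N`**, granted Deligne's bound: the Hecke
recursion `a_{p^{r+2}} = a_p a_{p^{r+1}} − p^{k−1} a_{p^r}` (Diamond–Shurman Prop. 5.8.5) makes
`a_{p^r} = ∑_{i+j=r} lⁱ mʲ` for the roots `l, m` of `IsNewform0.exists_roots_of_deligne`.
[cite: Deligne1974, Thm. 8.2 (p. 302)] [cite: DiamondShurman2005, Prop. 5.8.5] -/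
theorem IsNewform0.norm_cuspCoeff_prime_pow_le_of_not_dvd_of_deligne
    (hD : Deligne1974_heckeT_eigenvalue_norm_le) (hf : IsNewform0 f) (hk : 2 ≤ k) {p : ℕ}
    (hp : p.Prime) (hpN : ¬ p ∣ N) (r : ℕ) :
    ‖cuspCoeff f (p ^ r)‖ ≤ ((r : ℝ) + 1) * ((p : ℝ) ^ (((k : ℝ) - 1) / 2)) ^ r := by
  obtain ⟨l, m, hlm, hlm', hl, hm⟩ := hf.exists_roots_of_deligne hD hk hp hpN
  have h0 : cuspCoeff f (p ^ 0) = 1 := by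
    rw [pow_zero]; exact (isNormalized_iff_cuspCoeff_one f).mp hf.2.2
  have h1 : cuspCoeff f (p ^ 1) = l + m := by rw [pow_one, hlm]
  have hrec : ∀ r, cuspCoeff f (p ^ (r + 2)) =
      (l + m) * cuspCoeff f (p ^ (r + 1)) - l * m * cuspCoeff f (p ^ r) := fun r ↦ by
    rw [hf.cuspCoeff_prime_pow_add_two_weight hp r, if_neg hpN, hlm, hlm']
  exact norm_le_of_recurrence_of_norm_eq (by positivity) hl hm (c := fun r ↦ cuspCoeff f (p ^ r))
    h0 h1 hrec r

/-- **`|a_p(f)| ≤ p^{(k−1)/2}` at a prime `p ∣ N`** (unconditional; Atkin–Lehner 1970, Thm. 3):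
`a_p = 0` if `p² ∣ N` (`IsNewform0.cuspCoeff_eq_zero_of_sq_dvd`), and `a_p² = p^{k−2}` if `p ∥ N`
(`IsNewform0.coeff_sq_eq_of_exactly_dvd`), so `|a_p| = p^{k/2−1} ≤ p^{(k−1)/2}`.
[cite: AtkinLehner1970, Thm. 3] -/
theorem IsNewform0.norm_cuspCoeff_le_rpow_of_dvd (hf : IsNewform0 f) {p : ℕ} (hp : p.Prime)
    (hpN : p ∣ N) : ‖cuspCoeff f p‖ ≤ (p : ℝ) ^ (((k : ℝ) - 1) / 2) := by
  by_cases hp2 : p ^ 2 ∣ N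
  · rw [hf.cuspCoeff_eq_zero_of_sq_dvd hp hp2, norm_zero]
    positivity
  · obtain ⟨M, hM⟩ := hpN
    have hpM : ¬ p ∣ M := fun h ↦ hp2 (by rw [hM, pow_two]; exact mul_dvd_mul_left p h)
    haveI : Fact p.Prime := ⟨hp⟩
    have hsq : cuspCoeff f p ^ 2 = (p : ℂ) ^ (k - 2) :=
      IsNewform0.coeff_sq_eq_of_exactly_dvd hM hpM hf
    have hp0 : (0 : ℝ) ≤ p := Nat.cast_nonneg p
    have hp1 : (1 : ℝ) ≤ p := by exact_mod_cast hp.one_lt.le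
    have h1 : ‖cuspCoeff f p‖ ^ 2 = (p : ℝ) ^ ((k : ℝ) - 2) := by
      rw [← norm_pow, hsq, norm_zpow, Complex.norm_natCast, ← Real.rpow_intCast]
      push_cast
      ring_nf
    have h2 : ((p : ℝ) ^ (((k : ℝ) - 1) / 2)) ^ 2 = (p : ℝ) ^ ((k : ℝ) - 1) := by
      rw [← Real.rpow_natCast, ← Real.rpow_mul hp0]
      norm_num
    have h3 : (p : ℝ) ^ ((k : ℝ) - 2) ≤ (p : ℝ) ^ ((k : ℝ) - 1) :=
      Real.rpow_le_rpow_of_exponent_le hp1 (by linarith)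
    exact le_of_pow_le_pow_left₀ two_ne_zero (by positivity) (by rw [h1, h2]; exact h3)

/-- `a_{p^r} = a_p^r` at a prime `p ∣ N`, in every weight (the Hecke recursion degenerates:
`T_p = U_p`, `a_{p^{r+2}} = a_p a_{p^{r+1}}`; Diamond–Shurman Prop. 5.8.5). Private general-weight
copy of the weight-`2` lemma `IsNewform0.cuspCoeff_prime_pow_of_dvd`
(`NewformPeterssonSizeSymmSquareProofs`), kept local to avoid that file's imports.
[cite: DiamondShurman2005, Prop. 5.8.5] -/
private theorem IsNewform0.cuspCoeff_prime_pow_of_dvd_weight (hf : IsNewform0 f) {p : ℕ}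
    (hp : p.Prime) (hpN : p ∣ N) (r : ℕ) : cuspCoeff f (p ^ r) = cuspCoeff f p ^ r := by
  induction r using Nat.twoStepInduction with
  | zero => rw [pow_zero, pow_zero]; exact (isNormalized_iff_cuspCoeff_one f).mp hf.2.2
  | one => rw [pow_one, pow_one]
  | more r _ ih =>
    rw [hf.cuspCoeff_prime_pow_add_two_weight hp r, if_pos hpN, zero_mul, sub_zero, ih]
    ring

/-- **`|a_{p^r}(f)| ≤ (r+1) p^{r(k−1)/2}` at EVERY prime**, granted Deligne's bound at the primes
`p ∤ N` (`IsNewform0.norm_cuspCoeff_prime_pow_le_of_not_dvd_of_deligne`); at `p ∣ N` unconditionally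
(`a_{p^r} = a_p^r`; `|a_p|^r ≤ p^{r(k−1)/2}`). [cite: Deligne1974, Thm. 8.2 (p. 302)] [cite: AtkinLehner1970, Thm. 3] -/
theorem IsNewform0.norm_cuspCoeff_prime_pow_le_of_deligne
    (hD : Deligne1974_heckeT_eigenvalue_norm_le) (hf : IsNewform0 f) (hk : 2 ≤ k) {p : ℕ}
    (hp : p.Prime) (r : ℕ) :
    ‖cuspCoeff f (p ^ r)‖ ≤ ((r : ℝ) + 1) * ((p : ℝ) ^ (((k : ℝ) - 1) / 2)) ^ r := by
  by_cases hpN : p ∣ N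
  · rw [hf.cuspCoeff_prime_pow_of_dvd_weight hp hpN r, norm_pow]
    have hR : 0 ≤ (p : ℝ) ^ (((k : ℝ) - 1) / 2) := by positivity
    calc ‖cuspCoeff f p‖ ^ r ≤ ((p : ℝ) ^ (((k : ℝ) - 1) / 2)) ^ r :=
          pow_le_pow_left₀ (norm_nonneg _) (hf.norm_cuspCoeff_le_rpow_of_dvd hp hpN) r
      _ ≤ ((r : ℝ) + 1) * ((p : ℝ) ^ (((k : ℝ) - 1) / 2)) ^ r :=
          le_mul_of_one_le_left (pow_nonneg hR r) (by linarith [r.cast_nonneg (α := ℝ)])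
  · exact hf.norm_cuspCoeff_prime_pow_le_of_not_dvd_of_deligne hD hk hp hpN r

/-- **Divisor-function absorption**: `(r + 1) (p^e)^r ≤ B_p · (p^r)^{e + 1/8}` with `B_p = 16` for
`p < 256` and `B_p = 1` for `p ≥ 256` (`r + 1 ≤ 16 · 2^{r/8}`, `WeierstrassCurve.succ_le_sixteen_mul_two_rpow`;
for `p ≥ 256`, `p^{r/8} ≥ 2^r ≥ r + 1`). [folklore] -/
private theorem succ_mul_rpow_pow_le {p : ℕ} (hp : p.Prime) (e : ℝ) (r : ℕ) :
    ((r : ℝ) + 1) * ((p : ℝ) ^ e) ^ r ≤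
      (if p < 256 then (16 : ℝ) else 1) * ((p : ℝ) ^ r) ^ (e + 1 / 8) := by
  have hp0 : (0 : ℝ) ≤ p := Nat.cast_nonneg _
  have hp2 : (2 : ℝ) ≤ p := by exact_mod_cast hp.two_le
  -- `(p^e)^r = (p^r)^e` and `(p^r)^{e + 1/8} = (p^r)^e · p^{r/8}`
  have her : ((p : ℝ) ^ e) ^ r = ((p : ℝ) ^ r) ^ e := by
    rw [← Real.rpow_natCast, ← Real.rpow_mul hp0, ← Real.rpow_natCast (p : ℝ) r,
      ← Real.rpow_mul hp0, mul_comm]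
  have hprpos : (0 : ℝ) < (p : ℝ) ^ r := by positivity
  have h18 : ((p : ℝ) ^ r) ^ (1 / 8 : ℝ) = (p : ℝ) ^ ((r : ℝ) / 8) := by
    rw [← Real.rpow_natCast (p : ℝ) r, ← Real.rpow_mul hp0]
    ring_nf
  have hsplit : ((p : ℝ) ^ r) ^ (e + 1 / 8) = ((p : ℝ) ^ r) ^ e * (p : ℝ) ^ ((r : ℝ) / 8) := by
    rw [Real.rpow_add hprpos, h18]
  rw [her, hsplit]
  have hre : 0 ≤ ((p : ℝ) ^ r) ^ e := by positivity
  suffices h : ((r : ℝ) + 1) ≤ (if p < 256 then (16 : ℝ) else 1) * (p : ℝ) ^ ((r : ℝ) / 8) by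
    calc ((r : ℝ) + 1) * ((p : ℝ) ^ r) ^ e
        ≤ ((if p < 256 then (16 : ℝ) else 1) * (p : ℝ) ^ ((r : ℝ) / 8)) * ((p : ℝ) ^ r) ^ e :=
          mul_le_mul_of_nonneg_right h hre
      _ = _ := by ring
  split_ifs with h256
  · calc ((r : ℝ) + 1) ≤ 16 * (2 : ℝ) ^ ((r : ℝ) / 8) := by
          exact_mod_cast WeierstrassCurve.succ_le_sixteen_mul_two_rpow r
      _ ≤ 16 * (p : ℝ) ^ ((r : ℝ) / 8) := by gcongr
  · push Not at h256
    have h256' : (256 : ℝ) ≤ p := by exact_mod_cast h256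
    have hk2 : r + 1 ≤ 2 ^ r := Nat.lt_two_pow_self
    calc ((r : ℝ) + 1) ≤ (2 : ℝ) ^ r := by exact_mod_cast hk2
      _ = (256 : ℝ) ^ ((r : ℝ) / 8) := by
          rw [show (256 : ℝ) = 2 ^ (8 : ℝ) by norm_num, ← Real.rpow_mul (by norm_num),
            ← Real.rpow_natCast]
          ring_nf
      _ ≤ 1 * (p : ℝ) ^ ((r : ℝ) / 8) := by
          rw [one_mul]
          exact Real.rpow_le_rpow (by norm_num) h256' (by positivity)

/-- **Ramanujan–Petersson, crude global form**: granted Deligne's bound, a newform `f ∈ S_k(Γ₀(N))`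
(`k ≥ 2`) has `|aₙ(f)| ≤ 16^{256} · n^{(k−1)/2 + 1/8}` for every `n ≥ 1` (indeed
`|aₙ| ≤ d(n) n^{(k−1)/2}`: multiplicativity `IsNewform0.coeff_mul_of_coprime_holds`, the prime-power
bounds `IsNewform0.norm_cuspCoeff_prime_pow_le_of_deligne`, and `succ_mul_rpow_pow_le`, only the primes
`< 256` contributing a factor `16`). [cite: Deligne1974, Thm. 8.2 (p. 302)] [cite: DiamondShurman2005, Prop. 5.8.5] -/
theorem IsNewform0.norm_cuspCoeff_le_of_deligne (hD : Deligne1974_heckeT_eigenvalue_norm_le)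
    (hf : IsNewform0 f) (hk : 2 ≤ k) {n : ℕ} (hn : n ≠ 0) :
    ‖cuspCoeff f n‖ ≤ (16 : ℝ) ^ 256 * (n : ℝ) ^ (((k : ℝ) - 1) / 2 + 1 / 8) := by
  classical
  set e : ℝ := ((k : ℝ) - 1) / 2 with he
  -- multiplicativity: `aₙ = ∏_{p^r ∥ n} a_{p^r}`
  have hmul : cuspCoeff f n = n.factorization.prod fun p r ↦ cuspCoeff f (p ^ r) :=
    Nat.multiplicative_factorization (cuspCoeff f)
      (fun x y hxy ↦ IsNewform0.coeff_mul_of_coprime_holds hf hxy)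
      ((isNormalized_iff_cuspCoeff_one f).mp hf.2.2) hn
  -- `n^{e + 1/8} = ∏ (p^r)^{e + 1/8}`
  have hcast : (n : ℝ) = ∏ p ∈ n.factorization.support, (p : ℝ) ^ n.factorization p := by
    conv_lhs => rw [← Nat.prod_factorization_pow_eq_self hn]
    rw [Finsupp.prod, Nat.cast_prod]
    push_cast
    rfl
  have hne : (n : ℝ) ^ (e + 1 / 8) =
      ∏ p ∈ n.factorization.support, ((p : ℝ) ^ n.factorization p) ^ (e + 1 / 8) := by
    rw [hcast, ← Real.finsetProd_rpow _ _ (fun p _ ↦ by positivity)]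
  rw [hne, hmul, Finsupp.prod, norm_prod]
  -- the constants
  set B : ℕ → ℝ := fun p ↦ if p < 256 then (16 : ℝ) else 1 with hB
  have hB1 : ∀ p, 1 ≤ B p := fun p ↦ by simp only [hB]; split_ifs <;> norm_num
  have hB16 : ∀ p, B p ≤ 16 := fun p ↦ by simp only [hB]; split_ifs <;> norm_num
  calc ∏ p ∈ n.factorization.support, ‖cuspCoeff f (p ^ n.factorization p)‖
      ≤ ∏ p ∈ n.factorization.support, B p * (((p : ℝ) ^ n.factorization p) ^ (e + 1 / 8)) := by
        refine Finset.prod_le_prod (fun p _ ↦ norm_nonneg _) fun p hp ↦ ?_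
        have hpp : p.Prime := Nat.prime_of_mem_primeFactors (Nat.support_factorization n ▸ hp)
        exact (hf.norm_cuspCoeff_prime_pow_le_of_deligne hD hk hpp _).trans
          (succ_mul_rpow_pow_le hpp e _)
    _ = (∏ p ∈ n.factorization.support, B p) *
          ∏ p ∈ n.factorization.support, ((p : ℝ) ^ n.factorization p) ^ (e + 1 / 8) :=
        Finset.prod_mul_distrib
    _ ≤ (16 : ℝ) ^ 256 *
          ∏ p ∈ n.factorization.support, ((p : ℝ) ^ n.factorization p) ^ (e + 1 / 8) := by
        refine mul_le_mul_of_nonneg_right ?_ (Finset.prod_nonneg fun p _ ↦ by positivity)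
        -- only the primes `< 256` contribute a factor `16`
        rw [← Finset.prod_filter_mul_prod_filter_not _ (fun p ↦ p < 256)]
        have h2 : ∏ p ∈ n.factorization.support.filter (fun p ↦ ¬ p < 256), B p = 1 :=
          Finset.prod_eq_one fun p hp ↦ by
            simp only [hB, if_neg (Finset.mem_filter.mp hp).2]
        rw [h2, mul_one]
        calc ∏ p ∈ n.factorization.support.filter (fun p ↦ p < 256), B p
            ≤ ∏ p ∈ n.factorization.support.filter (fun p ↦ p < 256), (16 : ℝ) :=
              Finset.prod_le_prod (fun p _ ↦ by linarith [hB1 p]) fun p _ ↦ hB16 p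
          _ = 16 ^ (n.factorization.support.filter (fun p ↦ p < 256)).card := by
              rw [Finset.prod_const]
          _ ≤ 16 ^ 256 := by
              refine pow_le_pow_right₀ (by norm_num) ?_
              calc (n.factorization.support.filter (fun p ↦ p < 256)).card
                  ≤ (Finset.range 256).card := Finset.card_le_card fun p hp ↦
                    Finset.mem_range.mpr (Finset.mem_filter.mp hp).2
                _ = 256 := Finset.card_range 256

/-- **Absolute convergence of `L(f, s)` in Deligne's half-plane** (up to the divisor artefact `1/8`):
granted Deligne's bound, `∑ aₙ(f) n^{-s}` is summable for `re s > (k+1)/2 + 1/8` (Mathlib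
`LSeriesSummable_of_le_const_mul_rpow` with `IsNewform0.norm_cuspCoeff_le_of_deligne`).
[cite: Deligne1974, Thm. 8.2 (p. 302)] [cite: DiamondShurman2005, Thm. 5.9.2] -/
theorem IsNewform0.lseriesSummable_cuspCoeff_of_deligne (hD : Deligne1974_heckeT_eigenvalue_norm_le)
    (hf : IsNewform0 f) (hk : 2 ≤ k) {s : ℂ} (hs : ((k : ℝ) + 1) / 2 + 1 / 8 < s.re) :
    LSeriesSummable (cuspCoeff f) s := by
  refine LSeriesSummable_of_le_const_mul_rpow (x := ((k : ℝ) - 1) / 2 + 1 / 8 + 1) (by linarith)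
    ⟨(16 : ℝ) ^ 256, fun n hn ↦ ?_⟩
  have hx : ((k : ℝ) - 1) / 2 + 1 / 8 + 1 - 1 = ((k : ℝ) - 1) / 2 + 1 / 8 := by ring
  rw [hx]
  exact hf.norm_cuspCoeff_le_of_deligne hD hk hn

/-- **`L(f, s) ≠ 0` for `re s > (k+1)/2 + 1/8`, granted Deligne's bound** (newform
`f ∈ S_k(Γ₀(N))`, `k ≥ 2`): the Hecke recursions (`a₁ = 1`, `a_{pn} = a_p a_n − 𝟙_{p∤N} p^{k−1} a_{n/p}`,
`IsNewform0.cuspCoeff_prime_mul`) and absolute convergence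
(`IsNewform0.lseriesSummable_cuspCoeff_of_deligne`) feed the sieve argument
`HeckeRecursionLSeries.LSeries_ne_zero_of_heckeRecursion` (classically: the Euler product converges
absolutely, Diamond–Shurman Thm. 5.9.2). [cite: Deligne1974, Thm. 8.2 (p. 302)]
[cite: DiamondShurman2005, Thm. 5.9.2] -/
theorem IsNewform0.cuspFormLSeries_ne_zero_of_deligne (hD : Deligne1974_heckeT_eigenvalue_norm_le)
    (hf : IsNewform0 f) (hk : 2 ≤ k) {s : ℂ} (hs : ((k : ℝ) + 1) / 2 + 1 / 8 < s.re) :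
    cuspFormLSeries f s ≠ 0 := by
  refine HeckeRecursionLSeries.LSeries_ne_zero_of_heckeRecursion (a := cuspCoeff f) hf.2.2
    (fun p hp ↦ ?_) (hf.lseriesSummable_cuspCoeff_of_deligne hD hk hs)
  refine ⟨cuspCoeff f p, if p ∣ N then 0 else (p : ℂ) ^ (k - 1), fun n _ ↦ ?_⟩
  rw [hf.cuspCoeff_prime_mul hp n]
  split_ifs <;> ring

/-- **`L(f, s) ≠ 0` for `re s ≥ k/2 + 1`, granted Deligne's bound** — Hecke's half-plane WITH its
boundary (`k/2 + 1 > (k+1)/2 + 1/8`); the boundary `re s = k/2 + 1` is exactly the case the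
unconditional `IsNewform0.cuspFormLSeries_ne_zero` does not reach. [cite: Deligne1974, Thm. 8.2 (p. 302)]
[cite: DiamondShurman2005, Thm. 5.9.2] -/
theorem IsNewform0.cuspFormLSeries_ne_zero_of_le_re_of_deligne
    (hD : Deligne1974_heckeT_eigenvalue_norm_le) (hf : IsNewform0 f) (hk : 2 ≤ k) {s : ℂ}
    (hs : (k : ℝ) / 2 + 1 ≤ s.re) : cuspFormLSeries f s ≠ 0 :=
  hf.cuspFormLSeries_ne_zero_of_deligne hD hk (by linarith)

/-- **The last critical value `L(f, k − 1) ≠ 0` for a newform of weight `k ≥ 4`, granted Deligne's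
bound** (`k − 1 ≥ k/2 + 1 ⟺ k ≥ 4`); e.g. `L(g, p) ≠ 0` for a weight-`(p+1)` companion form `g` at
EVERY odd prime `p`, including `p = 3` (weight `4`, `s = 3`, the boundary of Hecke's half-plane).
[cite: Deligne1974, Thm. 8.2 (p. 302)] [cite: DiamondShurman2005, Thm. 5.9.2] -/
theorem IsNewform0.cuspFormLSeries_edge_ne_zero_of_deligne
    (hD : Deligne1974_heckeT_eigenvalue_norm_le) (hf : IsNewform0 f) (hk : 4 ≤ k) :
    cuspFormLSeries f ((k : ℂ) - 1) ≠ 0 := by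
  refine hf.cuspFormLSeries_ne_zero_of_le_re_of_deligne hD (by omega) ?_
  have hk' : (4 : ℝ) ≤ (k : ℝ) := by exact_mod_cast hk
  simp only [sub_re, intCast_re, one_re]
  linarith

end Newform

end Literature.NumberTheory.EllipticCurves.ModularForms

end
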